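import Literature.Combinatorics.Optimization.ShellLawRelativeLevelSmoothnessSub
import Literature.Combinatorics.Optimization.ShellLawCentredMomentLevelStep
import Summits.PneNP.PneNP.Theorems.ChebyshevTracialDesignShellOperatorForm
import HarnessLib

/-!
# Cell pnp-psdrank, route `ChebyshevTracialDesign`: the level-smoothness budgets of the PINNED law families (brick 135's `R₁, R₂`)
# (crux `TracialDecayExp20`, stmt-PneNP-19878)

Brick 136 (eng g25; MEMO-24 (eng) §3c, prover MEMO-30 §3 "k ≥ 2: termwise from the per-order law bounds for the three law families — the deleted
ones via transport"). Brick 135 (`…GammaDirectionLeibnizBounds.sum_abs_fwdDiff_iter_threeLaw_le`) consumes per-order budgets `c_i|Δ^iG_r(0)| ≤ R_r(i)`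
for the three law profiles of the Leibniz split: `G₀(j) = law_{[n]}(2s+1,2j+1;x)` (the tree's `abs_fwdDiff_iter_shellLaw_le_of_hyps`, Lq, directly) and the
PINNED families `G₁(j) = Σ_{v∈reps(vAA)} law_{[n]∖e_v}(2s−1,2j+1;x−2)`, `G₂(j) = Σ_vΣ_{w≠v} law_{[n]∖e_v∖e_w}(2s−3,2j+1;x−4)`, which live on DELETED
ground sets. This file supplies their budgets from the transported Lq (`ShellLawRelativeLevelSmoothnessSub`, eng g25):
* §1 structure of the one-pinned ground sets `[n] ∖ e_v`, `v ∈ reps(vAA)`: `π`-stability, type counts `(a−1, b, d)`, sizes `n−2`, `|H|−2`, shell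
  nonemptiness inherited from the matching's shells;
* §2 **`levelBudget_pin1`**: under Lq's margins for the parameters `(N₀−1; a−1,b,d; s−1; x′)` (stated verbatim, `x′` the family's own point),
  `c_k|Δ^kG₁(0)| ≤ Γq^k·G₁(0) + a·(4/3)^k e^{−(L−2D)²/(4(N₀−1))}` for `1 ≤ k ≤ D`;
* §3 the same for the two-pinned ground sets `del2 v w`, `(v,w) ∈ reps(vAA).offDiag` (type `(a−2,b,d)`), the rewriting
  `Σ_vΣ_{w∈reps.erase v} = Σ_{offDiag}` and **`levelBudget_pin2`** with the factor `a(a−1)` (= `|offDiag|`).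
WHAT THIS FILE DOES NOT DO: merge the three parameter sets (monotonicity in `N₀` is left to the assembly's numerics), the `k = 1` term, (V), or anything on
`TracialDecayExp20` itself, psd rank of P_PM(K_n), or P vs NP. [cite: Rothvoss2017, §2 (PDF p. 6)] [cite: RollinRoss2010, §4.1 Thm 4.2]
Stature: support/instrument (kernel lane, no defs, axioms standard). Supports stmt-PneNP-19878.
-/

set_option linter.dupNamespace false -- `Summit.PneNP.PneNP.…`: summit = sub-problem (D-0017)

noncomputable section

namespace Summit.PneNP.PneNP.Theorems.ChebyshevTracialDesignGammaDirectionLevelBudgets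

open Finset Literature.Barriers.PneNP Literature.Combinatorics.Optimization
open Literature.Combinatorics.Optimization.ShellStep
open Summit.PneNP.PneNP.Theorems.ChebyshevTracialDesignShellOperatorForm (shell_partner_nonempty)

variable {n : ℕ}

/-! ### §1 The one-pinned ground sets `[n] ∖ e_v` -/

/-- `[n] ∖ e_v` is `π`-stable. [cite: Rothvoss2017, §2 (PDF p. 6)] -/
theorem sdiff_pair_univ_stable (M : PMatch n) (v : Fin n) :
    ∀ u ∈ (univ : Finset (Fin n)) \ {v, M.2.partner v}, M.2.partner u ∈ (univ : Finset (Fin n)) \ {v, M.2.partner v} := by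
  intro u hu
  simp only [mem_sdiff, mem_univ, true_and, mem_insert, mem_singleton, not_or] at hu ⊢
  refine ⟨fun h => hu.2 ?_, fun h => hu.1 ?_⟩
  · rw [← h, partner_partner]
  · have := congrArg M.2.partner h
    rwa [partner_partner, partner_partner] at this

/-- `|[n] ∖ e_v| = n − 2`. [cite: Rothvoss2017, §2 (PDF p. 6)] -/
theorem card_sdiff_pair_univ (M : PMatch n) (v : Fin n) : ((univ : Finset (Fin n)) \ {v, M.2.partner v}).card = n - 2 := by
  rw [card_sdiff_of_subset (subset_univ _), card_univ, Fintype.card_fin, card_pair (partner_ne M v).symm]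

/-- For an `HH` edge `e_v`, `|([n] ∖ e_v) ∩ H| = |H| − 2`. [cite: Rothvoss2017, §2 (PDF p. 6)] -/
theorem card_sdiff_pair_inter (M : PMatch n) {H : Finset (Fin n)} {v : Fin n} (hv : v ∈ vAA M.2.partner univ H) :
    (((univ : Finset (Fin n)) \ {v, M.2.partner v}) ∩ H).card = H.card - 2 := by
  rw [vAA, mem_filter] at hv
  have hsub : ({v, M.2.partner v} : Finset (Fin n)) ⊆ H := by
    intro u hu; rw [mem_insert, mem_singleton] at hu; rcases hu with rfl | rfl; exacts [hv.2.1, hv.2.2]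
  have e : ((univ : Finset (Fin n)) \ {v, M.2.partner v}) ∩ H = H \ {v, M.2.partner v} := by
    ext u; simp only [mem_inter, mem_sdiff, mem_univ, true_and]; tauto
  rw [e, card_sdiff_of_subset hsub, card_pair (partner_ne M v).symm]

/-- Type counts of `[n] ∖ e_v` for `v ∈ reps(vAA)`: `(a−1, b, d)`. [cite: Rothvoss2017, §2 (PDF p. 6)] -/
theorem types_sdiff_pair (M : PMatch n) (H : Finset (Fin n)) {v : Fin n} (hv : v ∈ reps M.2.partner (vAA M.2.partner univ H)) :
    (reps M.2.partner (vAA M.2.partner (univ \ {v, M.2.partner v}) H)).card = (reps M.2.partner (vAA M.2.partner univ H)).card - 1 ∧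
    (reps M.2.partner (vBH M.2.partner (univ \ {v, M.2.partner v}) H ∪ vBN M.2.partner (univ \ {v, M.2.partner v}) H)).card =
      (reps M.2.partner (vBH M.2.partner univ H ∪ vBN M.2.partner univ H)).card ∧
    (reps M.2.partner (vDD M.2.partner (univ \ {v, M.2.partner v}) H)).card = (reps M.2.partner (vDD M.2.partner univ H)).card := by
  have hvA : v ∈ vAA M.2.partner univ H := (mem_filter.1 hv).1
  refine ⟨?_, ?_, ?_⟩
  · rw [reps_vAA_sdiff_pair (partner_partner M) hv, card_erase_of_mem hv]
  · rw [vBH_sdiff_pair_of_mem_vAA (partner_partner M) hvA, vBN_sdiff_pair_of_mem_vAA hvA]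
  · rw [vDD_sdiff_pair_of_mem_vAA hvA]

/-- Shells of `[n] ∖ e_v` at cut `2s′+1` are nonempty when the matching's shells at cut `2s′+3` are (`1 + 2k ≤ 2s′+1`, `2s′+3 + (1+2k) ≤ n`).
[cite: Rothvoss2017, §2 (PDF p. 6)] -/
theorem shellIn_sdiff_pair_nonempty (M : PMatch n) (v : Fin n) {s' k : ℕ} (hk : 1 + 2 * k ≤ 2 * s' + 1) (hkn : 2 * s' + 3 + (1 + 2 * k) ≤ n) :
    (shellIn M.2.partner ((univ : Finset (Fin n)) \ {v, M.2.partner v}) (2 * s' + 1) (1 + 2 * k)).Nonempty := by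
  have hne : (shellIn M.2.partner univ (2 * s' + 1 + 2) (1 + 2 * k)).Nonempty := by
    rw [shellIn_univ]
    exact shell_partner_nonempty M ⟨s' + 1, by ring⟩ ⟨k, by ring⟩ (by omega) (by omega)
  exact shellIn_sdiff_pair_nonempty_of_full (partner_partner M) (partner_ne M) (fun u _ => mem_univ _) (mem_univ v) hne (by omega)

/-! ### §2 The budget of the one-pinned family `G₁` -/

/-- **Budget `R₁` of the one-pinned law family** `G₁(j) = Σ_{v∈reps(vAA)} law_{[n]∖e_v}(2s′+1,2j+1;x′)`: under Lq's hypotheses for the deleted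
parameters (`N₁` edges, `a₁ = a−1`, the same `b, d`, cut index `s′`, point `x′`, margins verbatim from `abs_fwdDiff_iter_shellLaw_le_of_hyps_sub`),
`c_k|Δ^kG₁(0)| ≤ Γq^k·G₁(0) + |reps(vAA)|·(4/3)^k·exp(−(L−2D)²/(4N₁))` for `1 ≤ k ≤ D`.
[cite: Rothvoss2017, §2 (PDF p. 6)] [cite: RollinRoss2010, §4.1 Thm 4.2] -/
theorem levelBudget_pin1 (M : PMatch n) (H : Finset (Fin n)) {a₁ b d N₁ : ℕ}
    (ha : (reps M.2.partner (vAA M.2.partner univ H)).card = a₁ + 1)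
    (hb : (reps M.2.partner (vBH M.2.partner univ H ∪ vBN M.2.partner univ H)).card = b)
    (hd : (reps M.2.partner (vDD M.2.partner univ H)).card = d) (hN : a₁ + b + d = N₁) (hn : n - 2 = 2 * N₁)
    {β : ℝ} (hβ : 0 < β) (hβ1 : β ≤ 1 / 4) {D : ℕ} (hDN : 16 * D + 16 ≤ N₁)
    (hbβ : β * N₁ + 2 * D + 1 ≤ b) (hdβ : β * N₁ + 2 * D + 1 ≤ d)
    {s' : ℕ} (hs : β * N₁ + D ≤ s') (hs'' : 8 * (s' : ℝ) ≤ (4 + β) * ((N₁ : ℝ) - 2 * D))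
    (hks : 1 + 2 * D ≤ 2 * s' + 1) (hkn : 2 * s' + 3 + (1 + 2 * D) ≤ n)
    {x' : ℕ} {ε : ℝ} (hxε : |(x' : ℝ) - (2 * (s' : ℝ) + 1) * ((H.card - 2 : ℕ) : ℝ) / ((n - 2 : ℕ) : ℝ)| < ε) (hxD : 2 * D ≤ x')
    {L : ℝ} (h2D : 2 * (D : ℝ) ≤ L) (hLN : 2 * L ≤ N₁)
    (h1 : L + D + (ε + 14 * D + 1) ≤ β ^ 2 * N₁)
    (h2 : L + D + (ε + 14 * D + 1) + 3 ≤ β * ((N₁ : ℝ) - 2 * D) / 8)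
    (h3 : 2 * (L + D + 1) ≤ (β ^ 2 / 8) ^ 2 * (β * ((N₁ : ℝ) - 2 * D)))
    (h4 : 4 ≤ β * ((N₁ : ℝ) - 2 * D))
    (h5 : (D : ℝ) * (1 + 8 * (L + D + 1) / ((β ^ 2 / 8) ^ 4 * (β * ((N₁ : ℝ) - 2 * D)))) ≤
      (β ^ 2 / 8) ^ 4 * (β * ((N₁ : ℝ) - 2 * D))) :
    ∀ k ∈ Ico 1 (D + 1), (((2 * k).choose k : ℕ) : ℝ) / (4 : ℝ) ^ k *
        |(fwdDiff (1 : ℕ))^[k] (fun j => ∑ v ∈ reps M.2.partner (vAA M.2.partner univ H),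
            shellLaw M.2.partner (univ \ {v, M.2.partner v}) H (2 * s' + 1) (2 * j + 1) x') 0| ≤
      (1 + 4 * (Real.sqrt N₁ + 1) / 3 *
          (2 * Real.sqrt 192 * Real.sqrt (2 * (2 * (D : ℝ) + 1) * (1 + 8 * (L + D + 1) / ((β ^ 2 / 8) ^ 4 * (β * ((N₁ : ℝ) - 2 * D)))) /
            ((β ^ 2 / 8) ^ 4 * (β * ((N₁ : ℝ) - 2 * D)))))) *
          (4 * ((1 + 8 * (L + D + 1) / ((β ^ 2 / 8) ^ 4 * (β * ((N₁ : ℝ) - 2 * D)))) *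
          (8 * (L + D + 1) / ((β ^ 2 / 8) ^ 4 * (β * ((N₁ : ℝ) - 2 * D))) +
            2 * Real.sqrt 192 * Real.sqrt (2 * (2 * (D : ℝ) + 1) * (1 + 8 * (L + D + 1) / ((β ^ 2 / 8) ^ 4 * (β * ((N₁ : ℝ) - 2 * D)))) /
            ((β ^ 2 / 8) ^ 4 * (β * ((N₁ : ℝ) - 2 * D)))))) ^ 2 / (3 * β)) ^ k *
          (∑ v ∈ reps M.2.partner (vAA M.2.partner univ H), shellLaw M.2.partner (univ \ {v, M.2.partner v}) H (2 * s' + 1) 1 x') +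
        (reps M.2.partner (vAA M.2.partner univ H)).card * ((4 / 3 : ℝ) ^ k * Real.exp (-((L - 2 * D) ^ 2 / (4 * N₁)))) := by
  refine abs_fwdDiff_iter_sum_shellLaw_le_of_hyps_sub (partner_partner M) (partner_ne M) (reps M.2.partner (vAA M.2.partner univ H))
    (fun v => univ \ {v, M.2.partner v}) (fun v _ => sdiff_pair_univ_stable M v) H
    (fun v hv => by rw [(types_sdiff_pair M H hv).1, ha, Nat.add_sub_cancel]) (fun v hv => by rw [(types_sdiff_pair M H hv).2.1, hb])
    (fun v hv => by rw [(types_sdiff_pair M H hv).2.2, hd]) hN (fun v _ => by rw [card_sdiff_pair_univ M v, hn]) hβ hβ1 hDN hbβ hdβ hs hs''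
    (fun v _ k hk => shellIn_sdiff_pair_nonempty M v (by omega) (by omega)) (fun v hv => ?_) hxD h2D hLN h1 h2 h3 h4 h5
  rw [card_sdiff_pair_inter M (mem_filter.1 hv).1, card_sdiff_pair_univ M v]
  exact hxε

/-! ### §3 The two-pinned ground sets `[n] ∖ e_v ∖ e_w` and the budget of `G₂` -/

/-- The double sum over `v ∈ reps(vAA)`, `w ∈ reps(vAA).erase v` is a sum over `reps(vAA).offDiag`. [cite: Rothvoss2017, §2 (PDF p. 6)] -/
theorem sum_sum_erase_eq_sum_offDiag {ι : Type*} [DecidableEq ι] (R : Finset ι) (f : ι → ι → ℝ) :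
    ∑ v ∈ R, ∑ w ∈ R.erase v, f v w = ∑ p ∈ R.offDiag, f p.1 p.2 := by
  rw [sum_finset_product' R.offDiag R (fun v => R.erase v)]
  intro p
  rw [mem_offDiag, mem_erase]
  tauto

/-- For `v ∈ reps(vAA)` and `w ∈ reps(vAA).erase v`: `w ∈ reps(vAA([n] ∖ e_v))`. [cite: Rothvoss2017, §2 (PDF p. 6)] -/
theorem mem_reps_vAA_sdiff_pair (M : PMatch n) (H : Finset (Fin n)) {v w : Fin n}
    (hv : v ∈ reps M.2.partner (vAA M.2.partner univ H)) (hw : w ∈ (reps M.2.partner (vAA M.2.partner univ H)).erase v) :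
    w ∈ reps M.2.partner (vAA M.2.partner (univ \ {v, M.2.partner v}) H) := by
  rw [reps_vAA_sdiff_pair (partner_partner M) hv]; exact hw

/-- **Budget `R₂` of the two-pinned law family** `G₂(j) = Σ_vΣ_{w≠v} law_{del2 v w}(2s″+1,2j+1;x″)` (ground sets `[n]∖e_v∖e_w`, type `(a−2,b,d)`):
under Lq's hypotheses for the twice-deleted parameters (`N₂` edges, `a₂ = a−2`, cut index `s″`, point `x″`),
`c_k|Δ^kG₂(0)| ≤ Γq^k·G₂(0) + |reps(vAA)|(|reps(vAA)|−1)·(4/3)^k·exp(−(L−2D)²/(4N₂))` for `1 ≤ k ≤ D`.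
[cite: Rothvoss2017, §2 (PDF p. 6)] [cite: RollinRoss2010, §4.1 Thm 4.2] -/
theorem levelBudget_pin2 (M : PMatch n) (H : Finset (Fin n)) {a₂ b d N₂ : ℕ}
    (ha : (reps M.2.partner (vAA M.2.partner univ H)).card = a₂ + 2)
    (hb : (reps M.2.partner (vBH M.2.partner univ H ∪ vBN M.2.partner univ H)).card = b)
    (hd : (reps M.2.partner (vDD M.2.partner univ H)).card = d) (hN : a₂ + b + d = N₂) (hn : n - 4 = 2 * N₂)
    {β : ℝ} (hβ : 0 < β) (hβ1 : β ≤ 1 / 4) {D : ℕ} (hDN : 16 * D + 16 ≤ N₂)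
    (hbβ : β * N₂ + 2 * D + 1 ≤ b) (hdβ : β * N₂ + 2 * D + 1 ≤ d)
    {s'' : ℕ} (hs : β * N₂ + D ≤ s'') (hs'' : 8 * (s'' : ℝ) ≤ (4 + β) * ((N₂ : ℝ) - 2 * D))
    (hks : 1 + 2 * D ≤ 2 * s'' + 1) (hkn : 2 * s'' + 5 + (1 + 2 * D) ≤ n)
    {x'' : ℕ} {ε : ℝ} (hxε : |(x'' : ℝ) - (2 * (s'' : ℝ) + 1) * ((H.card - 4 : ℕ) : ℝ) / ((n - 4 : ℕ) : ℝ)| < ε) (hxD : 2 * D ≤ x'')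
    {L : ℝ} (h2D : 2 * (D : ℝ) ≤ L) (hLN : 2 * L ≤ N₂)
    (h1 : L + D + (ε + 14 * D + 1) ≤ β ^ 2 * N₂)
    (h2 : L + D + (ε + 14 * D + 1) + 3 ≤ β * ((N₂ : ℝ) - 2 * D) / 8)
    (h3 : 2 * (L + D + 1) ≤ (β ^ 2 / 8) ^ 2 * (β * ((N₂ : ℝ) - 2 * D)))
    (h4 : 4 ≤ β * ((N₂ : ℝ) - 2 * D))
    (h5 : (D : ℝ) * (1 + 8 * (L + D + 1) / ((β ^ 2 / 8) ^ 4 * (β * ((N₂ : ℝ) - 2 * D)))) ≤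
      (β ^ 2 / 8) ^ 4 * (β * ((N₂ : ℝ) - 2 * D))) :
    ∀ k ∈ Ico 1 (D + 1), (((2 * k).choose k : ℕ) : ℝ) / (4 : ℝ) ^ k *
        |(fwdDiff (1 : ℕ))^[k] (fun j => ∑ v ∈ reps M.2.partner (vAA M.2.partner univ H),
            ∑ w ∈ (reps M.2.partner (vAA M.2.partner univ H)).erase v,
              shellLaw M.2.partner (del2 M.2.partner univ v w) H (2 * s'' + 1) (2 * j + 1) x'') 0| ≤
      (1 + 4 * (Real.sqrt N₂ + 1) / 3 *
          (2 * Real.sqrt 192 * Real.sqrt (2 * (2 * (D : ℝ) + 1) * (1 + 8 * (L + D + 1) / ((β ^ 2 / 8) ^ 4 * (β * ((N₂ : ℝ) - 2 * D)))) /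
            ((β ^ 2 / 8) ^ 4 * (β * ((N₂ : ℝ) - 2 * D)))))) *
          (4 * ((1 + 8 * (L + D + 1) / ((β ^ 2 / 8) ^ 4 * (β * ((N₂ : ℝ) - 2 * D)))) *
          (8 * (L + D + 1) / ((β ^ 2 / 8) ^ 4 * (β * ((N₂ : ℝ) - 2 * D))) +
            2 * Real.sqrt 192 * Real.sqrt (2 * (2 * (D : ℝ) + 1) * (1 + 8 * (L + D + 1) / ((β ^ 2 / 8) ^ 4 * (β * ((N₂ : ℝ) - 2 * D)))) /
            ((β ^ 2 / 8) ^ 4 * (β * ((N₂ : ℝ) - 2 * D)))))) ^ 2 / (3 * β)) ^ k *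
          (∑ v ∈ reps M.2.partner (vAA M.2.partner univ H), ∑ w ∈ (reps M.2.partner (vAA M.2.partner univ H)).erase v,
            shellLaw M.2.partner (del2 M.2.partner univ v w) H (2 * s'' + 1) 1 x'') +
        ((reps M.2.partner (vAA M.2.partner univ H)).card * (reps M.2.partner (vAA M.2.partner univ H)).card -
            (reps M.2.partner (vAA M.2.partner univ H)).card : ℕ) *
          ((4 / 3 : ℝ) ^ k * Real.exp (-((L - 2 * D) ^ 2 / (4 * N₂)))) := by
  set π := M.2.partner with hπdef
  have hπ : ∀ v, π (π v) = v := partner_partner M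
  have hπ' : ∀ v, π v ≠ v := partner_ne M
  set R := reps π (vAA π univ H) with hR
  -- rewrite the double sums as sums over `R.offDiag`
  have e1 : (fun j => ∑ v ∈ R, ∑ w ∈ R.erase v, shellLaw π (del2 π univ v w) H (2 * s'' + 1) (2 * j + 1) x'') =
      fun j => ∑ p ∈ R.offDiag, shellLaw π (del2 π univ p.1 p.2) H (2 * s'' + 1) (2 * j + 1) x'' := by
    funext j; exact sum_sum_erase_eq_sum_offDiag R _
  have e2 : ∑ v ∈ R, ∑ w ∈ R.erase v, shellLaw π (del2 π univ v w) H (2 * s'' + 1) 1 x'' =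
      ∑ p ∈ R.offDiag, shellLaw π (del2 π univ p.1 p.2) H (2 * s'' + 1) 1 x'' := sum_sum_erase_eq_sum_offDiag R _
  rw [e1, e2, ← offDiag_card]
  -- structural facts of `del2 v w = ([n] ∖ e_v) ∖ e_w`
  have hmem : ∀ p ∈ R.offDiag, p.1 ∈ R ∧ p.2 ∈ R.erase p.1 := by
    intro p hp; rw [mem_offDiag] at hp; exact ⟨hp.1, mem_erase.2 ⟨hp.2.2.symm, hp.2.1⟩⟩
  have hstab1 : ∀ v : Fin n, ∀ u ∈ (univ : Finset (Fin n)) \ {v, π v}, π u ∈ (univ : Finset (Fin n)) \ {v, π v} :=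
    fun v => sdiff_pair_univ_stable M v
  have hstab2 : ∀ v w : Fin n, ∀ u ∈ del2 π univ v w, π u ∈ del2 π univ v w := by
    intro v w u hu
    rw [← sdiff_sdiff_eq_del2] at hu ⊢
    simp only [mem_sdiff, mem_insert, mem_singleton, not_or, mem_univ, true_and] at hu ⊢
    refine ⟨⟨fun h => hu.1.2 ?_, fun h => hu.1.1 ?_⟩, fun h => hu.2.2 ?_, fun h => hu.2.1 ?_⟩
    · rw [← h, hπ]
    · have := congrArg π h; rwa [hπ, hπ] at this
    · rw [← h, hπ]
    · have := congrArg π h; rwa [hπ, hπ] at this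
  refine abs_fwdDiff_iter_sum_shellLaw_le_of_hyps_sub hπ hπ' R.offDiag
    (fun p => del2 π univ p.1 p.2) (fun p _ => hstab2 p.1 p.2) H
    (fun p hp => ?_) (fun p hp => ?_) (fun p hp => ?_) hN (fun p hp => ?_) hβ hβ1 hDN hbβ hdβ hs hs''
    (fun p hp k hk => ?_) (fun p hp => ?_) hxD h2D hLN h1 h2 h3 h4 h5
  · -- `a`-count: two representatives removed
    obtain ⟨h1', h2'⟩ := hmem p hp
    have hw := mem_reps_vAA_sdiff_pair M H h1' h2'
    rw [← sdiff_sdiff_eq_del2, reps_vAA_sdiff_pair hπ hw, card_erase_of_mem hw, reps_vAA_sdiff_pair hπ h1', card_erase_of_mem h1', ha]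
    omega
  · obtain ⟨h1', h2'⟩ := hmem p hp
    have hw := mem_reps_vAA_sdiff_pair M H h1' h2'
    have hwA : p.2 ∈ vAA π (univ \ {p.1, π p.1}) H := (mem_filter.1 hw).1
    have hvA : p.1 ∈ vAA π univ H := (mem_filter.1 h1').1
    rw [← sdiff_sdiff_eq_del2, vBH_sdiff_pair_of_mem_vAA hπ hwA, vBN_sdiff_pair_of_mem_vAA hwA,
      vBH_sdiff_pair_of_mem_vAA hπ hvA, vBN_sdiff_pair_of_mem_vAA hvA, hb]
  · obtain ⟨h1', h2'⟩ := hmem p hp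
    have hw := mem_reps_vAA_sdiff_pair M H h1' h2'
    have hwA : p.2 ∈ vAA π (univ \ {p.1, π p.1}) H := (mem_filter.1 hw).1
    have hvA : p.1 ∈ vAA π univ H := (mem_filter.1 h1').1
    rw [← sdiff_sdiff_eq_del2, vDD_sdiff_pair_of_mem_vAA hwA, vDD_sdiff_pair_of_mem_vAA hvA, hd]
  · -- size `n − 4`
    obtain ⟨h1', h2'⟩ := hmem p hp
    have hw := mem_reps_vAA_sdiff_pair M H h1' h2'
    have hwS : p.2 ∈ (univ : Finset (Fin n)) \ {p.1, π p.1} := (mem_filter.1 (mem_filter.1 hw).1).1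
    have hπwS : π p.2 ∈ (univ : Finset (Fin n)) \ {p.1, π p.1} := hstab1 p.1 p.2 hwS
    have hsub : ({p.2, π p.2} : Finset (Fin n)) ⊆ (univ : Finset (Fin n)) \ {p.1, π p.1} := by
      intro u hu; rw [mem_insert, mem_singleton] at hu; rcases hu with rfl | rfl; exacts [hwS, hπwS]
    rw [← sdiff_sdiff_eq_del2, card_sdiff_of_subset hsub, card_sdiff_pair_univ M p.1, card_pair (hπ' p.2).symm, ← hn]
    omega
  · -- nonempty shells: delete twice from the matching's shells at cut `2s″+5`
    have hne0 : (shellIn π univ (2 * s'' + 1 + 2 + 2) (1 + 2 * k)).Nonempty := by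
      rw [shellIn_univ]; exact shell_partner_nonempty M ⟨s'' + 2, by ring⟩ ⟨k, by ring⟩ (by omega) (by omega)
    have hne1 : (shellIn π (univ \ {p.1, π p.1}) (2 * s'' + 1 + 2) (1 + 2 * k)).Nonempty :=
      shellIn_sdiff_pair_nonempty_of_full (partner_partner M) (partner_ne M) (fun u _ => mem_univ _) (mem_univ p.1) hne0 (by omega)
    obtain ⟨h1', h2'⟩ := hmem p hp
    have hw := mem_reps_vAA_sdiff_pair M H h1' h2'
    have hwS : p.2 ∈ (univ : Finset (Fin n)) \ {p.1, π p.1} := (mem_filter.1 (mem_filter.1 hw).1).1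
    rw [← sdiff_sdiff_eq_del2]
    exact shellIn_sdiff_pair_nonempty_of_full (partner_partner M) (partner_ne M) (hstab1 p.1) hwS hne1 (by omega)
  · -- the block size `|H| − 4` and the ground-set size `n − 4`
    obtain ⟨h1', h2'⟩ := hmem p hp
    have hw := mem_reps_vAA_sdiff_pair M H h1' h2'
    have hwA : p.2 ∈ vAA π (univ \ {p.1, π p.1}) H := (mem_filter.1 hw).1
    have hvA : p.1 ∈ vAA π univ H := (mem_filter.1 h1').1
    have hwS : p.2 ∈ (univ : Finset (Fin n)) \ {p.1, π p.1} := (mem_filter.1 hwA).1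
    have hπwS : π p.2 ∈ (univ : Finset (Fin n)) \ {p.1, π p.1} := hstab1 p.1 p.2 hwS
    have hsub : ({p.2, π p.2} : Finset (Fin n)) ⊆ (univ : Finset (Fin n)) \ {p.1, π p.1} := by
      intro u hu; rw [mem_insert, mem_singleton] at hu; rcases hu with rfl | rfl; exacts [hwS, hπwS]
    have hsubH : ({p.2, π p.2} : Finset (Fin n)) ⊆ H := by
      intro u hu; rw [mem_insert, mem_singleton] at hu
      rw [vAA, mem_filter] at hwA
      rcases hu with rfl | rfl; exacts [hwA.2.1, hwA.2.2]
    have ecard : (del2 π univ p.1 p.2).card = n - 4 := by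
      rw [← sdiff_sdiff_eq_del2, card_sdiff_of_subset hsub, card_sdiff_pair_univ M p.1, card_pair (hπ' p.2).symm]
      omega
    have einter : (del2 π univ p.1 p.2 ∩ H).card = H.card - 4 := by
      have e : del2 π univ p.1 p.2 ∩ H = (((univ : Finset (Fin n)) \ {p.1, π p.1}) ∩ H) \ {p.2, π p.2} := by
        rw [← sdiff_sdiff_eq_del2]; ext u; simp only [mem_inter, mem_sdiff]; tauto
      have hsub' : ({p.2, π p.2} : Finset (Fin n)) ⊆ ((univ : Finset (Fin n)) \ {p.1, π p.1}) ∩ H := by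
        intro u hu; exact mem_inter.2 ⟨hsub hu, hsubH hu⟩
      rw [e, card_sdiff_of_subset hsub', card_sdiff_pair_inter M hvA, card_pair (hπ' p.2).symm]
      omega
    rw [ecard, einter]
    exact hxε

/-! ### §4 (v2) Merging the three parameter sets: Lq's margins are monotone in the number of edges -/

/-- **Monotonicity of Lq's margins in `N₀`** (v2, eng g25). The real-valued side conditions of `abs_fwdDiff_iter_shellLaw_le_of_hyps(_sub)` —
`2L ≤ N`, `(h1) L+D+Λ ≤ β²N`, `(h2) L+D+Λ+3 ≤ β(N−2D)/8`, `(h3) 2(L+D+1) ≤ (β²/8)²·β(N−2D)`, `(h4) 4 ≤ β(N−2D)`,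
`(h5) D(1 + 8(L+D+1)/((β²/8)⁴β(N−2D))) ≤ (β²/8)⁴β(N−2D)` (`Λ = ε+14D+1`) — all pass from a smaller `N′` to a larger `N` (`0 < β`, `0 ≤ D`, `2D ≤ L`).
So bricks 135/136 need them ONCE, at `N′ = N₀ − 2` (the two-pinned family), for all three families; the integer conditions `16D+16 ≤ N`, and
`βN+2D+1 ≤ b, d` (at the LARGEST `N = N₀`), `βN₀ + D ≤ s − 2`, `8s ≤ (4+β)(N₀−2−2D)` are merged by `omega`/`linarith` at the call site.
[cite: RollinRoss2010, §4.1 Thm 4.2] -/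
theorem lqMargins_mono {β L ε N' N : ℝ} {D : ℕ} (hβ : 0 < β) (h2D : 2 * (D : ℝ) ≤ L) (hN'N : N' ≤ N)
    (hLN : 2 * L ≤ N') (h1 : L + D + (ε + 14 * D + 1) ≤ β ^ 2 * N')
    (h2 : L + D + (ε + 14 * D + 1) + 3 ≤ β * (N' - 2 * D) / 8)
    (h3 : 2 * (L + D + 1) ≤ (β ^ 2 / 8) ^ 2 * (β * (N' - 2 * D)))
    (h4 : 4 ≤ β * (N' - 2 * D))
    (h5 : (D : ℝ) * (1 + 8 * (L + D + 1) / ((β ^ 2 / 8) ^ 4 * (β * (N' - 2 * D)))) ≤ (β ^ 2 / 8) ^ 4 * (β * (N' - 2 * D))) :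
    2 * L ≤ N ∧ L + D + (ε + 14 * D + 1) ≤ β ^ 2 * N ∧
      L + D + (ε + 14 * D + 1) + 3 ≤ β * (N - 2 * D) / 8 ∧
      2 * (L + D + 1) ≤ (β ^ 2 / 8) ^ 2 * (β * (N - 2 * D)) ∧ 4 ≤ β * (N - 2 * D) ∧
      (D : ℝ) * (1 + 8 * (L + D + 1) / ((β ^ 2 / 8) ^ 4 * (β * (N - 2 * D)))) ≤ (β ^ 2 / 8) ^ 4 * (β * (N - 2 * D)) := by
  have hD0 : (0 : ℝ) ≤ D := Nat.cast_nonneg D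
  have hc0 : (0 : ℝ) < (β ^ 2 / 8) := by positivity
  have hmono : β * (N' - 2 * D) ≤ β * (N - 2 * D) := by nlinarith
  have hA'pos : 0 < (β ^ 2 / 8) ^ 4 * (β * (N' - 2 * D)) := by
    have : (0 : ℝ) < (β ^ 2 / 8) ^ 4 := by positivity
    nlinarith
  have hAA : (β ^ 2 / 8) ^ 4 * (β * (N' - 2 * D)) ≤ (β ^ 2 / 8) ^ 4 * (β * (N - 2 * D)) :=
    mul_le_mul_of_nonneg_left hmono (by positivity)
  have hK0 : 0 ≤ 8 * (L + (D : ℝ) + 1) := by linarith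
  refine ⟨by linarith, ?_, ?_, ?_, by linarith, ?_⟩
  · have : β ^ 2 * N' ≤ β ^ 2 * N := mul_le_mul_of_nonneg_left hN'N (by positivity)
    linarith
  · have : β * (N' - 2 * D) / 8 ≤ β * (N - 2 * D) / 8 := by linarith
    linarith
  · have : (β ^ 2 / 8) ^ 2 * (β * (N' - 2 * D)) ≤ (β ^ 2 / 8) ^ 2 * (β * (N - 2 * D)) :=
      mul_le_mul_of_nonneg_left hmono (by positivity)
    linarith
  · have hfrac : 8 * (L + (D : ℝ) + 1) / ((β ^ 2 / 8) ^ 4 * (β * (N - 2 * D))) ≤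
        8 * (L + (D : ℝ) + 1) / ((β ^ 2 / 8) ^ 4 * (β * (N' - 2 * D))) :=
      div_le_div_of_nonneg_left hK0 hA'pos hAA
    have : (D : ℝ) * (1 + 8 * (L + D + 1) / ((β ^ 2 / 8) ^ 4 * (β * (N - 2 * D)))) ≤
        (D : ℝ) * (1 + 8 * (L + D + 1) / ((β ^ 2 / 8) ^ 4 * (β * (N' - 2 * D)))) :=
      mul_le_mul_of_nonneg_left (by linarith) hD0
    linarith

end Summit.PneNP.PneNP.Theorems.ChebyshevTracialDesignGammaDirectionLevelBudgets
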